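import Literature.LinearAlgebra.Matrix.QInversiveSemisimpleCompletion
import Literature.LinearAlgebra.Matrix.JordanFormPolynomials
import Literature.LinearAlgebra.SemisimpleElementaryDivisors
import HarnessLib

/-!
# Goresky–Tai 2017, Prop. 38 «moreover, γ may be chosen to be semisimple»: a semisimple `q`-inversive element of
# `GSp_{2n}` with characteristic polynomial `xⁿh(x + q/x)` — through a semisimple matrix with characteristic
# polynomial `h` (block-diagonal companion matrices of the irreducible factors of `h`)

Topic `Literature/LinearAlgebra/Matrix`; THEOREMS ONLY (no definition, no instance, no named fact; D-0026 net
debt 0).  Lane `lit-hodgefound` (summit `HodgeConjecture`, Track 2 foundations library), seat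
`lit-hodgefound-p15`, generation 56, row g56-#13; sequel of `QInversiveCompanion` (g56-#4: PROP. 38, a
`q`-inversive `γ` with prescribed `q`-palindromic characteristic polynomial, not necessarily semisimple) and
`QInversiveSemisimpleCompletion` (g56-#11: COR. 39 with semisimplicity).

THE PRINT.  M. Goresky, Y.-S. Tai, *Real structures on ordinary Abelian varieties*, arXiv:1701.07742
[GoreskyTai2017RealStructuresOrdinary], App. §16.2 Proposition 38 and its proof (p0037–p0038), verbatim:

> Proposition 38. Let `p(x) ∈ ℚ[x]` be a `q`-palindromic polynomial of degree `2n`. Then there exists a element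
> `γ ∈ GSp_{2n}(ℚ)` with multiplier `q`, whose characteristic polynomial is `p(x)`. Moreover, `γ` may be chosen
> to be semisimple, in which case it is uniquely determined up to conjugacy in `GSp_{2n}(ℚ̄)` by its
> characteristic polynomial `p(x)`.
> *Proof.* … It is nonsingular (but not necessarily semisimple unless the roots of `h(x)` are distinct). … If the
> roots of `p(x)` are distinct then this element `γ` is semisimple. However if `p(x)` has repeated roots it is
> necessary to proceed as follows. Factor `h(x) = ∏ⱼ hⱼ^{mⱼ}(x)` into its irreducible factors over `ℚ`. … Take
> `A = Diag(A₁^{×m₁}, ⋯, A_r^{×m_r})` to be a block-diagonal matrix with `mⱼ` copies of the matrix `Aⱼ`. … It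
> suffices to show that each nonzero `γⱼ` is semisimple. Since `hⱼ(x)` is irreducible over `ℚ`, its roots are
> distinct, and the roots of `pⱼ(x)` are the solutions to `x² − 2αx + q = 0` where `hⱼ(α) = 0`. If `±√q` is not a
> root of `hⱼ(x)` then the roots of `pⱼ(x)` are distinct, hence `γⱼ` is semisimple. If `±√q` is a root of `hⱼ(x)`
> then … [special blocks].

WHAT IS HERE (any field for §1; a perfect field with `2 ≠ 0`, `q ≠ 0` for §2 — GT: `ℚ`):
* §1 **`exists_isSemisimple_charpoly_eq`**: every monic `c ∈ K[x]` is the characteristic polynomial of a SEMISIMPLE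
  matrix (GT's `A = Diag(A₁^{×m₁}, ⋯)`: the block-diagonal matrix of the companion matrices of the irreducible
  factors of `c`, counted with multiplicity, is killed by the square-free `rad c`); tools `X_pow_add_sum_coeff_eq`,
  `isUnit_det_aeval_of_isCoprime_charpoly` (`(p_M, g) = 1 ⟹ g(M)` invertible).
* §2 **`exists_semisimple_qInversive_transform`** — PROP. 38 «moreover» in the case `h` has no root `±2√q`
  (`(h, x² − 4q) = 1`; in the normalisation `p_γ = 𝒯_q(p_{2A})` of `QInversiveCharpoly` this is GT's «`±√q` is
  not a root of `hⱼ`»): a SEMISIMPLE `q`-inversive `γ = (A B; C ᵗA)` with multiplier `q`, nonsingular `B, C`, and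
  `p_γ = xⁿh(x + q/x)`; here `A = ½M` for the semisimple `M` of §1 with `p_M = h`, and `B, C` come from COR. 39
  (`QInversiveSemisimpleCompletion`).  Every `q`-palindromic `p` is such a `𝒯_q(h)`
  (`QPalindromicRealCounterpart.existsUnique_monic_eq_transform`).

NOT here: the exceptional blocks for `h(±2√q) = 0` (`p = (x − √q)²`, `(x² − q)²`) and the uniqueness up to
`GSp_{2n}(ℚ̄)`-conjugacy (Prop. 13); `GL`-conjugacy of semisimple matrices with equal characteristic polynomial
is the tree's `SemisimpleSimilarityCharpoly`.

## References
* [GoreskyTai2017RealStructuresOrdinary] M. Goresky, Y.-S. Tai, Real structures on ordinary Abelian varieties,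
  arXiv:1701.07742 (2017), App. §16.2 Proposition 38 with proof (p0037–p0038).
-/

open Matrix Polynomial UniqueFactorizationMonoid

namespace Literature.LinearAlgebra.Matrix.QInversiveSemisimpleRepresentative

variable {K : Type*} [Field K]

/-! ## §1 A semisimple matrix with prescribed characteristic polynomial -/

/-- A monic `P` is `x^{deg P} + ∑_{j < deg P} P_j x^j` (the companion-matrix normal form of its coefficients).
[cite: GoreskyTai2017RealStructuresOrdinary, App. §16.2 proof of Prop. 38 «The matrix A is the companion matrix for the polynomial h(x)» (p0037)] -/
theorem X_pow_add_sum_coeff_eq {P : K[X]} (hP : P.Monic) :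
    X ^ P.natDegree + ∑ j : Fin P.natDegree, C (P.coeff j) * X ^ (j : ℕ) = P := by
  rw [Fin.sum_univ_eq_sum_range (fun j => C (P.coeff j) * X ^ j) P.natDegree]
  exact hP.as_sum.symm

/-- If `g` is coprime to the characteristic polynomial of `M` then `g(M)` is invertible (Cayley–Hamilton).
[cite: GoreskyTai2017RealStructuresOrdinary, App. §16.2 proof of Prop. 38 «If ±√q is not a root of hⱼ(x) then … γⱼ is semisimple» (p0038)] -/
theorem isUnit_det_aeval_of_isCoprime_charpoly {n : Type*} [Fintype n] [DecidableEq n] {M : Matrix n n K}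
    {g : K[X]} (h : IsCoprime M.charpoly g) : IsUnit (aeval M g).det := by
  obtain ⟨a, b, hab⟩ := h
  have h1 := congrArg (aeval M) hab
  rw [map_add, map_mul, map_mul, Matrix.aeval_self_charpoly, mul_zero, zero_add, map_one] at h1
  exact Matrix.isUnit_det_of_left_inverse h1

/-- **Every monic polynomial is the characteristic polynomial of a semisimple matrix** (any field): the
block-diagonal matrix of the companion matrices of the monic irreducible factors of `c`, with multiplicity, has
characteristic polynomial `c` and is annihilated by the square-free `rad c`.
[cite: GoreskyTai2017RealStructuresOrdinary, App. §16.2 proof of Prop. 38 «Factor h(x) = ∏ hⱼ^{mⱼ}(x) into its irreducible factors … Take A = Diag(A₁^{×m₁}, ⋯, A_r^{×m_r}) … Since hⱼ(x) is irreducible over ℚ, its roots are distinct» (p0038)] -/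
theorem exists_isSemisimple_charpoly_eq (c : K[X]) (hc : c.Monic) :
    ∃ M : Matrix (Fin c.natDegree) (Fin c.natDegree) K,
      Module.End.IsSemisimple (Matrix.toLin' M) ∧ M.charpoly = c := by
  classical
  set L := (normalizedFactors c).toList with hL
  have hmemL : ∀ i : Fin L.length, L.get i ∈ normalizedFactors c := fun i => by
    rw [← Multiset.mem_toList]
    exact List.get_mem L i
  have hmon : ∀ i : Fin L.length, (L.get i).Monic := fun i =>
    (normalize_eq_self_iff_monic (prime_of_normalized_factor _ (hmemL i)).ne_zero).mp
      (normalize_normalized_factor _ (hmemL i))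
  have hPi : ∀ i : Fin L.length,
      X ^ (L.get i).natDegree + ∑ j : Fin (L.get i).natDegree, C ((L.get i).coeff j) * X ^ (j : ℕ) = L.get i :=
    fun i => X_pow_add_sum_coeff_eq (hmon i)
  set M₀ : Matrix (Σ i : Fin L.length, Fin (L.get i).natDegree) (Σ i : Fin L.length, Fin (L.get i).natDegree) K :=
    Matrix.blockDiagonal' fun i => companion fun j : Fin (L.get i).natDegree => (L.get i).coeff j with hM₀
  -- characteristic polynomial
  have hchar : M₀.charpoly = c := by
    rw [hM₀, charpoly_blockDiagonal']
    have h1 : (∏ i : Fin L.length, (companion fun j : Fin (L.get i).natDegree => (L.get i).coeff j).charpoly) =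
        ∏ i : Fin L.length, L.get i :=
      Finset.prod_congr rfl fun i _ => by rw [charpoly_companion, hPi]
    rw [h1, ← List.prod_ofFn, List.ofFn_get, hL, Multiset.prod_toList]
    have hmp : (normalizedFactors c).prod.Monic := by
      have h := monic_multiset_prod_of_monic (normalizedFactors c) id fun P hP =>
        (normalize_eq_self_iff_monic (prime_of_normalized_factor _ hP).ne_zero).mp (normalize_normalized_factor _ hP)
      rwa [Multiset.map_id] at h
    exact eq_of_monic_of_associated hmp hc (prod_normalizedFactors hc.ne_zero)
  -- semisimplicity: `rad c` kills every block
  have hss : Module.End.IsSemisimple (Matrix.toLin' M₀) := by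
    refine Module.End.isSemisimple_of_squarefree_aeval_eq_zero
      (Literature.LinearAlgebra.squarefree_prod_normalizedFactors_toFinset c) ?_
    rw [QInversiveSemisimple.aeval_toLin', hM₀, aeval_blockDiagonal']
    have h0 : (fun i : Fin L.length => aeval (companion fun j : Fin (L.get i).natDegree => (L.get i).coeff j)
        (∏ P ∈ (normalizedFactors c).toFinset, P)) = 0 := by
      funext i
      have hmem : L.get i ∈ (normalizedFactors c).toFinset := Multiset.mem_toFinset.mpr (hmemL i)
      obtain ⟨t, ht⟩ := Finset.dvd_prod_of_mem (fun P : K[X] => P) hmem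
      have hz : aeval (companion fun j : Fin (L.get i).natDegree => (L.get i).coeff j) (L.get i) = 0 := by
        have h := aeval_companion_eq_zero (fun j : Fin (L.get i).natDegree => (L.get i).coeff j)
        rwa [hPi i] at h
      rw [Pi.zero_apply, ht, map_mul, hz, zero_mul]
    rw [h0, Matrix.blockDiagonal'_zero, map_zero]
  -- re-index by `Fin (deg c)`
  have hcard : Fintype.card (Σ i : Fin L.length, Fin (L.get i).natDegree) = c.natDegree := by
    rw [← hchar, Matrix.charpoly_natDegree_eq_dim]
  let e := Fintype.equivFinOfCardEq hcard
  refine ⟨Matrix.reindex e e M₀, ?_, by rw [Matrix.charpoly_reindex, hchar]⟩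
  obtain ⟨s, hs, hs0⟩ := (QInversiveSemisimple.isSemisimple_toLin'_iff M₀).mp hss
  refine (QInversiveSemisimple.isSemisimple_toLin'_iff _).mpr ⟨s, hs, ?_⟩
  have h := aeval_algHom_apply (Matrix.reindexAlgEquiv K K e) M₀ s
  rw [hs0, map_zero, Matrix.coe_reindexAlgEquiv] at h
  exact h

/-- With a prescribed size `n = deg c`. [cite: GoreskyTai2017RealStructuresOrdinary, App. §16.2 proof of Prop. 38 (p0038)] -/
theorem exists_isSemisimple_charpoly_eq' {n : ℕ} (c : K[X]) (hc : c.Monic) (hn : c.natDegree = n) :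
    ∃ M : Matrix (Fin n) (Fin n) K, Module.End.IsSemisimple (Matrix.toLin' M) ∧ M.charpoly = c := by
  subst hn
  exact exists_isSemisimple_charpoly_eq c hc

/-! ## §2 Proposition 38 «moreover»: a semisimple `q`-inversive element with characteristic polynomial `𝒯_q(h)` -/

/-- **PROPOSITION 38, «γ may be chosen to be semisimple»** (perfect field, `2 ≠ 0`, `q ≠ 0`; `h` monic of
degree `n` with no root `±2√q`, i.e. `(h, x² − 4q) = 1`): there is a SEMISIMPLE `γ = (A B; D ᵗA) ∈ GSp_{2n}(K)`
with the `q`-inversive relations, multiplier `q`, nonsingular `B, D`, and characteristic polynomial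
`xⁿh(x + q/x) = ∑ⱼ hⱼ x^{n−j}(x² + q)ʲ`.
[cite: GoreskyTai2017RealStructuresOrdinary, App. §16.2 Prop. 38 «Moreover, γ may be chosen to be semisimple» and proof (p0037–p0038)] -/
theorem exists_semisimple_qInversive_transform [PerfectField K] (h2 : (2 : K) ≠ 0) {q : K} (hq0 : q ≠ 0)
    {n : ℕ} {h : K[X]} (hm : h.Monic) (hn : h.natDegree = n) (hcop : IsCoprime h (X ^ 2 - C (4 * q))) :
    ∃ A B D : Matrix (Fin n) (Fin n) K, Bᵀ = B ∧ Dᵀ = D ∧ A * B = B * Aᵀ ∧ D * A = Aᵀ * D ∧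
      A * A - B * D = q • (1 : Matrix (Fin n) (Fin n) K) ∧ B.det ≠ 0 ∧ D.det ≠ 0 ∧
      (fromBlocks A B D Aᵀ)ᵀ * J (Fin n) K * fromBlocks A B D Aᵀ = q • J (Fin n) K ∧
      Module.End.IsSemisimple (Matrix.toLin' (fromBlocks A B D Aᵀ)) ∧
      (fromBlocks A B D Aᵀ).charpoly =
        ∑ j ∈ Finset.range (n + 1), C (h.coeff j) * X ^ (n - j) * (X ^ 2 + C q) ^ j := by
  obtain ⟨M, hMss, hMc⟩ := exists_isSemisimple_charpoly_eq' h hm hn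
  have h4 : (4 : K) ≠ 0 := by
    rw [show (4 : K) = 2 * 2 by norm_num]
    exact mul_ne_zero h2 h2
  set A := (2⁻¹ : K) • M with hA
  have hAA : A + A = M := by rw [hA, ← two_smul K, smul_smul, mul_inv_cancel₀ h2, one_smul]
  have hAss : Module.End.IsSemisimple (Matrix.toLin' A) :=
    (QInversiveSemisimple.isSemisimple_toLin'_smul_iff (inv_ne_zero h2) M).mpr hMss
  have hAA2 : A * A = (4 : K)⁻¹ • (M * M) := by
    rw [hA, Matrix.smul_mul, Matrix.mul_smul, smul_smul, ← mul_inv, show (2 : K) * 2 = 4 by norm_num]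
  have hdet : (A * A - q • (1 : Matrix (Fin n) (Fin n) K)).det ≠ 0 := by
    have hu : IsUnit (aeval M (X ^ 2 - C (4 * q))).det :=
      isUnit_det_aeval_of_isCoprime_charpoly (by rw [hMc]; exact hcop)
    have he : aeval M (X ^ 2 - C (4 * q)) = (4 : K) • (A * A - q • (1 : Matrix (Fin n) (Fin n) K)) := by
      rw [map_sub, map_pow, aeval_X, aeval_C, Algebra.algebraMap_eq_smul_one, sq, hAA2, smul_sub, smul_smul,
        smul_smul, mul_inv_cancel₀ h4, one_smul]
    rw [he, det_smul] at hu
    exact (isUnit_of_mul_isUnit_right hu).ne_zero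
  obtain ⟨B, D, hB, hD, hAB, hDA, hq, hBd, hDd, hmul, hss⟩ :=
    QInversiveSemisimpleCompletion.exists_qInversive_semisimple_completion h2 A hq0 hAss hdet
  refine ⟨A, B, D, hB, hD, hAB, hDA, hq, hBd, hDd, hmul, hss, ?_⟩
  rw [QInversiveCharpoly.charpoly_eq_transform_charpoly_two_smul hB hD hAB hDA hq, Fintype.card_fin, hAA, hMc]

end Literature.LinearAlgebra.Matrix.QInversiveSemisimpleRepresentative
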